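import Mathlib.RingTheory.Ideal.Norm.AbsNorm
import Mathlib.RingTheory.Ideal.MinimalPrime.Noetherian
import Mathlib.RingTheory.Ideal.Quotient.Operations
import Literature.NumberTheory.EllipticCurves.CuspFormsGamma0IntegralBasisProofs
import HarnessLib

/-!
# The Hecke ring `𝕋 = ℤ[T_p : p ∤ N]` of `S_k(Γ₀(N))`, eigen-ideals, and Pasten's congruence
# modulus `η_{[χ₀]}([χ])`

Definitions (with proved API) giving a typed home to congruence-number statements between
systems of Hecke eigenvalues, as used by H. Pasten, *Shimura curves and the abc conjecture*,
J. Number Theory 254 (2024) = arXiv:1705.09251, §4.8–§4.11 and §5.4, in the classical case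
`D = 1`, `M = N` (the modular curve `X₀(N)`).

**The source.** Pasten, §4.8 (p. 15): the Hecke correspondences `T_{U,n}`, `n` coprime to the
level, "generate a commutative ring `𝕋_U^c`", and `𝕋_U` is its image in
`End(H⁰(X_U, Ω¹))`; §4.9 (p. 16): the action of `𝕋_{D,M}` on
`V_{D,M} = H⁰(X_0^D(M), Ω¹) ⊗ ℂ` "is simultaneously diagonalizable, which gives rise to systems
of Hecke eigenvalues `χ : 𝕋_{D,M} → ℂ`", and for `D = 1` one may replace `V_{1,N}` by
`S₂(N) = S₂(Γ₀(N))` (§4.10); §4.11 (p. 16): "All the elements of `[χ]` have the same kernel,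
which we denote by `𝕀_{[χ]}`"; §5.1 (p. 17): `χ₀` is the (`ℤ`-valued) system of Hecke
eigenvalues of the elliptic curve; §5.4 (p. 17): *"Given `[χ]` an equivalence class of systems of
eigenvalues on `𝕋_{D,M}` different to `[χ₀]`, let us define the congruence modulus
`η_{[χ₀]}([χ]) := [ℤ·f : 𝕀_{[χ]}·f]` where `f` is any non-zero element of `V_{D,M}^{χ₀}`"*, and
Prop. 5.4: *"`η_{[χ₀]}([χ])` is the largest positive integer `m` with the following property:
given any polynomial `P ∈ ℤ[x₁,…,x_ℓ]` and positive integers `n₁,…,n_ℓ` coprime to `N`, if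
`P(χ(T_{n₁}),…,χ(T_{n_ℓ})) = 0` then `m` divides `P(χ₀(T_{n₁}),…,χ₀(T_{n_ℓ}))`"*.

**This file** (namespace `Literature.NumberTheory.EllipticCurves.ModularForms`, next to
`HeckeOperators`, `HeckeIntegrality`, `CuspFormsGamma0IntegralBasisProofs`):

* `congruenceModulus I J := #(R ⧸ (I ⊔ J))` for two ideals of a commutative ring (`0` if the
  quotient is infinite) — the abstract *congruence module order*; `congruenceModulus_comm`;
  `congruenceModulus_ker_eq_card`: `#(R ⧸ (ker χ ⊔ I)) = #(S ⧸ χ(I))` for `χ : R →+* S` onto;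
  `congruenceModulus_ker_eq_absNorm`: for `χ₀ : R →+* ℤ`, `#(R ⧸ (ker χ₀ ⊔ I)) = [ℤ : χ₀(I)]`
  (Mathlib's `Ideal.absNorm`), i.e. **Pasten's `[ℤ·f : 𝕀·f] = [ℤ : χ₀(𝕀)]`** since `𝕋` acts on
  the line `ℂ f = V^{χ₀}` through `χ₀`; and the abstract core of Prop. 5.4:
  `congruenceModulus_dvd_of_mem` (`η ∣ χ₀(t)` for `t ∈ 𝕀`) and
  `dvd_congruenceModulus_of_forall_dvd` (`η` is the largest such integer).
* `anemicHeckeRing N k := ℤ[T_p : p prime, p ∤ N] ⊆ End_ℂ(S_k(Γ₀(N)))` — Pasten's `𝕋_{1,N}`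
  (generated by the `T_n`, `(n, N) = 1`; the same ring, as `T_n ∈ ℤ[T_p : p ∣ n]` for `(n, N) = 1`
  by `T_{mn} = T_m T_n`, `T_{p^{r+1}} = T_p T_{p^r} - p^{k-1} T_{p^{r-1}}`, Diamond–Shurman
  §5.3 / Shimura Thm. 3.24), in every weight `k`, with **instances proved from the tree**:
  `CommRing` (`heckeT_comm_gamma0_holds`), `Module.Finite ℤ` and `Module.Free ℤ` (Shimura's
  Thm. 3.48 (1) via the tree's Hecke-stable lattice `gamma0_exists_heckeStableLattice_holds` and
  `finite_heckeRing0`), `IsNoetherianRing`, and `finite_minimalPrimes` (the classes `[χ]` are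
  the minimal primes `𝕀_{[χ]}` of `𝕋`, finitely many).
* `eigenIdeal f := {t ∈ 𝕋 | t f = 0}` (an ideal; for a nonzero simultaneous eigenvector `f` it
  is the kernel `𝕀_{[χ_f]}` of its eigencharacter, `eigenIdeal_eq_ker_eigencharacter`, hence
  prime, `isPrime_eigenIdeal`); `IsAnemicEigenvector f` (`T_p f ∈ ℂ f` for all `p ∤ N`; every
  `IsHeckeEigenform` is one); `eigencharacter hf hf0 : 𝕋 →+* ℂ` (`t f = χ_f(t) f`) and, for
  integral eigenvalues, `intEigencharacter : 𝕋 →+* ℤ` (Pasten's `χ₀`).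
* `heckeCongruenceModulus f P := congruenceModulus (eigenIdeal f) P = #(𝕋 ⧸ (𝕀_{[χ_f]} + P))`
  — **Pasten's `η_{[χ₀]}([χ])`** when `f ∈ V^{χ₀}` and `P = 𝕀_{[χ]}`:
  `heckeCongruenceModulus_eq_relIndex` (`= [ℤ·f : P·f]`, Pasten's definition verbatim) and
  `heckeCongruenceModulus_eq_absNorm` (`= [ℤ : χ₀(P)]`),
  `heckeCongruenceModulus_dvd_of_mem` / `dvd_heckeCongruenceModulus_of_forall_dvd` (Prop. 5.4:
  an integer relation `P(χ(T_{nᵢ})) = 0` is an element `t = P(T_{nᵢ}) ∈ ker χ`, and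
  `χ₀(t) = P(χ₀(T_{nᵢ}))`; every `t ∈ 𝕋` is such a polynomial).

Related but different: `congruenceNumber f` of `CongruenceNumber.lean` is the (total) congruence
number `r_f = #(S_k(Γ₀(N); ℤ) ⧸ (ℤf + (ℤf)^⊥))` of Agashe–Ribet–Stein 2012, §2.1, defined through
Fourier coefficients of all forms; Pasten's `η_{[χ₀]}([χ])` is orbit-by-orbit and lives in the
Hecke ring (2024, §1.3: "congruences of systems of Hecke eigenvalues (thus only involving
eigenforms) instead of Fourier expansions of all modular forms").

Not vendored here (named facts belong to the cite item for Pasten Thm. 5.5 / Prop. 5.4 / Thm. 7.2):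
the spectral divisibility `δ_{1,N} ∣ ∏_{[χ] ≠ [χ₀]} η_{[χ₀]}([χ])` (Thm. 5.5) and the size bound
for `η` (proof of Thm. 7.2); nor the reducedness of `𝕋` / total reality of `𝕋 ⧸ P` (§4.9,
"takes values in the ring of integers of a totally real number field").

## References

* H. Pasten, *Shimura curves and the abc conjecture*, J. Number Theory 254 (2024), 214–335,
  doi:10.1016/j.jnt.2023.07.002, arXiv:1705.09251: §4.8–4.11 (pp. 15–16), §5.1, §5.4 and
  Prop. 5.4 (p. 17), Thm. 5.5 (p. 18). [PastenShimura2024]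
* G. Shimura, *Introduction to the arithmetic theory of automorphic functions*, 1971, Thm. 3.41,
  Thm. 3.48, (3.5.20). [Shimura1971]
* F. Diamond, J. Shurman, *A first course in modular forms*, GTM 228, 2005, Prop. 5.2.4,
  Prop. 5.3.1, §6.5. [DiamondShurman2005]
-/

noncomputable section

open scoped MatrixGroups ModularForm

open CongruenceSubgroup

namespace Literature.NumberTheory.EllipticCurves.ModularForms

/-! ### The congruence modulus of two ideals of a commutative ring -/

section CommAlgebra

variable {R : Type*} [CommRing R]

/-- The **congruence modulus** (order of the congruence module) of two ideals `I, J` of a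
commutative ring `R`: the cardinality of `R ⧸ (I + J)`, with the convention `0` when this quotient
is infinite (`Nat.card`). For `R = 𝕋` a Hecke ring, `J = ker χ₀` and `I = ker χ` the kernels of
two systems of eigenvalues this is Pasten's `η_{[χ₀]}([χ])`
(`congruenceModulus_ker_eq_absNorm`, `heckeCongruenceModulus`); its prime divisors are the
congruence primes between `χ` and `χ₀` (Pasten 2024, §5.4, p. 17). [cite: PastenShimura2024, §5.4 p. 17] -/
def congruenceModulus (I J : Ideal R) : ℕ :=
  Nat.card (R ⧸ (I ⊔ J))

/-- Unfolding lemma for `congruenceModulus`. [folklore] -/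
theorem congruenceModulus_def (I J : Ideal R) :
    congruenceModulus I J = Nat.card (R ⧸ (I ⊔ J)) :=
  rfl

/-- The congruence modulus is symmetric in the two ideals. [folklore] -/
theorem congruenceModulus_comm (I J : Ideal R) :
    congruenceModulus I J = congruenceModulus J I := by
  unfold congruenceModulus
  rw [sup_comm]

/-- The congruence modulus is `1` iff the two ideals are comaximal (no congruence at all).
[folklore] -/
theorem congruenceModulus_eq_one_iff (I J : Ideal R) :
    congruenceModulus I J = 1 ↔ I ⊔ J = ⊤ := by
  rw [congruenceModulus, Nat.card_eq_one_iff_unique, ← Ideal.Quotient.subsingleton_iff]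
  exact ⟨fun h ↦ h.1, fun h ↦ ⟨h, ⟨0⟩⟩⟩

/-- The congruence modulus is nonzero iff the congruence module `R ⧸ (I + J)` is finite.
[folklore] -/
theorem congruenceModulus_ne_zero_iff (I J : Ideal R) :
    congruenceModulus I J ≠ 0 ↔ Finite (R ⧸ (I ⊔ J)) := by
  refine ⟨fun h ↦ Nat.finite_of_card_ne_zero h, fun h ↦ ?_⟩
  rw [congruenceModulus]
  exact Nat.card_pos.ne'

variable {S : Type*} [CommRing S]

/-- For a surjective ring map `χ : R → S` and an ideal `I ≤ R`:
`R ⧸ (ker χ + I) ≃+* S ⧸ χ(I)`. [folklore] -/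
def quotKerSupEquiv (χ : R →+* S) (hχ : Function.Surjective χ) (I : Ideal R) :
    R ⧸ (RingHom.ker χ ⊔ I) ≃+* S ⧸ I.map χ :=
  (DoubleQuot.quotQuotEquivQuotSup (RingHom.ker χ) I).symm.trans
    (Ideal.quotientEquiv _ _ (RingHom.quotientKerEquivOfSurjective hχ) (by
      rw [Ideal.map_map]
      rfl))

/-- `#(R ⧸ (ker χ + I)) = #(S ⧸ χ(I))` for `χ : R → S` surjective. [folklore] -/
theorem congruenceModulus_ker_eq_card (χ : R →+* S) (hχ : Function.Surjective χ) (I : Ideal R) :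
    congruenceModulus (RingHom.ker χ) I = Nat.card (S ⧸ I.map χ) :=
  Nat.card_congr (quotKerSupEquiv χ hχ I).toEquiv

/-- A ring map to `ℤ` is surjective. [folklore] -/
theorem surjective_of_ringHom_int (χ : R →+* ℤ) : Function.Surjective χ :=
  fun n ↦ ⟨n, by simp⟩

/-- **Pasten's form of the congruence modulus.** For a `ℤ`-valued character `χ₀ : R → ℤ` and an
ideal `I` (the common kernel `𝕀_{[χ]}` of a class of eigen-systems),
`#(R ⧸ (ker χ₀ + I)) = [ℤ : χ₀(I)]` (Mathlib: `Ideal.absNorm (I.map χ₀)`); when `R = 𝕋` acts on the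
`χ₀`-eigenline `ℂ f` this index is `[ℤ·f : I·f]`, Pasten's definition of `η_{[χ₀]}([χ])`
(2024, §5.4, p. 17). [cite: PastenShimura2024, §5.4 p. 17] -/
theorem congruenceModulus_ker_eq_absNorm (χ : R →+* ℤ) (I : Ideal R) :
    congruenceModulus (RingHom.ker χ) I = Ideal.absNorm (I.map χ) := by
  rw [congruenceModulus_ker_eq_card χ (surjective_of_ringHom_int χ) I, Ideal.absNorm_apply,
    Submodule.cardQuot_apply]

/-- **Pasten 2024, Prop. 5.4, first half (abstract form):** the congruence modulus
`η = #(R ⧸ (ker χ₀ + I))` divides `χ₀(t)` for every `t ∈ I`. (In Prop. 5.4: an integer polynomial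
relation `P(χ(T_{n₁}),…,χ(T_{n_ℓ})) = 0` is an element `t = P(T_{n₁},…,T_{n_ℓ}) ∈ ker χ = I`, and
`χ₀(t) = P(χ₀(T_{n₁}),…,χ₀(T_{n_ℓ}))`.) [cite: PastenShimura2024, Prop. 5.4 p. 17] -/
theorem congruenceModulus_dvd_of_mem (χ : R →+* ℤ) {I : Ideal R} {t : R} (ht : t ∈ I) :
    (congruenceModulus (RingHom.ker χ) I : ℤ) ∣ χ t := by
  rw [congruenceModulus_ker_eq_absNorm, ← Ideal.mem_span_singleton,
    Int.ideal_span_absNorm_eq_self]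
  exact Ideal.mem_map_of_mem χ ht

/-- **Pasten 2024, Prop. 5.4, second half (abstract form):** `η = #(R ⧸ (ker χ₀ + I))` is the
largest integer dividing `χ₀(t)` for all `t ∈ I` — every such `m` divides `η`. [cite: PastenShimura2024, Prop. 5.4 p. 17] -/
theorem dvd_congruenceModulus_of_forall_dvd (χ : R →+* ℤ) {I : Ideal R} {m : ℕ}
    (h : ∀ t ∈ I, (m : ℤ) ∣ χ t) : m ∣ congruenceModulus (RingHom.ker χ) I := by
  rw [congruenceModulus_ker_eq_absNorm]
  have hle : I.map χ ≤ Ideal.span {(m : ℤ)} := by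
    rw [Ideal.map_le_iff_le_comap]
    intro t ht
    rw [Ideal.mem_comap, Ideal.mem_span_singleton]
    exact h t ht
  have := Ideal.absNorm_dvd_absNorm_of_le hle
  rwa [Ideal.absNorm_span_natCast, Module.finrank_self, pow_one] at this

end CommAlgebra

/-! ### The Hecke ring `𝕋 = ℤ[T_p : p ∤ N]` of `S_k(Γ₀(N))` -/

section HeckeRing

variable (N : ℕ) [NeZero N] (k : ℤ)

/-- The generators of the (anemic) Hecke ring of `S_k(Γ₀(N))`: the operators
`T_p = heckeT (Gamma0 N) k p` for the primes `p ∤ N`. [folklore] -/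
def anemicHeckeGenerators : Set (Module.End ℂ (CuspForm (Gamma0 N) k)) :=
  {T | ∃ (p : ℕ) (hp : p.Prime), ¬p ∣ N ∧
    T = (haveI : NeZero p := ⟨hp.ne_zero⟩; heckeT (Gamma0 N) k p)}

/-- The **(anemic) Hecke ring** `𝕋 = 𝕋_{1,N} := ℤ[T_p : p prime, p ∤ N] ⊆ End_ℂ(S_k(Γ₀(N)))` of
level `Γ₀(N)` and weight `k`: the subring generated over `ℤ` by the Hecke operators at the primes
not dividing the level, acting on the whole of `S_k(Γ₀(N))` (old forms included). This is Pasten's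
`𝕋_{D,M}` for `D = 1`, `M = N` (2024, §4.8 p. 15: the ring generated by the Hecke
correspondences `T_{U,n}`, `n` coprime to the level, acting on `H⁰(X_U, Ω¹) ⊗ ℂ ≅ S₂(Γ₀(N))`,
§4.6, §4.10); generating by the `T_n`, `(n, N) = 1`, or by the `T_p`, `p ∤ N`, gives the same
ring (`T_{mn} = T_m T_n` for coprime `m, n` and `T_{p^{r+1}} = T_p T_{p^r} - p^{k-1} T_{p^{r-1}}`
for `p ∤ N`, Diamond–Shurman §5.3). It is commutative (`instCommRingAnemicHeckeRing`), and free of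
finite rank over `ℤ` (`Module.Finite`/`Module.Free` instances below). The full ring
`ℤ[T_p : all p]` (with the `U_p`, `p ∣ N`) is the local `𝕋` of
`CuspFormsGamma0IntegralBasisProofs`; see `anemicHeckeRing_le_adjoin`. [cite: PastenShimura2024, §4.8 p. 15 and §4.10 p. 16] -/
def anemicHeckeRing : Subalgebra ℤ (Module.End ℂ (CuspForm (Gamma0 N) k)) :=
  Algebra.adjoin ℤ (anemicHeckeGenerators N k)

/-- `T_p ∈ 𝕋` for `p` prime, `p ∤ N`. [folklore] -/
theorem heckeT_mem_anemicHeckeRing (p : ℕ) [NeZero p] (hp : p.Prime) (hpN : ¬p ∣ N) :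
    heckeT (Gamma0 N) k p ∈ anemicHeckeRing N k :=
  Algebra.subset_adjoin ⟨p, hp, hpN, rfl⟩

/-- The operator `T_p`, `p ∤ N` prime, as an element of the Hecke ring `𝕋`. [folklore] -/
def anemicHeckeRing.T (p : ℕ) [NeZero p] (hp : p.Prime) (hpN : ¬p ∣ N) : anemicHeckeRing N k :=
  ⟨heckeT (Gamma0 N) k p, heckeT_mem_anemicHeckeRing N k p hp hpN⟩

/-- Unfolding lemma for `anemicHeckeRing.T`. [folklore] -/
@[simp] theorem anemicHeckeRing.coe_T (p : ℕ) [NeZero p] (hp : p.Prime) (hpN : ¬p ∣ N) :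
    ((anemicHeckeRing.T N k p hp hpN : anemicHeckeRing N k) :
      Module.End ℂ (CuspForm (Gamma0 N) k)) = heckeT (Gamma0 N) k p :=
  rfl

/-- The anemic Hecke ring is contained in the full Hecke ring `ℤ[T_p : p prime]` (which also
contains the `U_p = T_p`, `p ∣ N`). [folklore] -/
theorem anemicHeckeRing_le_adjoin :
    anemicHeckeRing N k ≤ Algebra.adjoin ℤ {T : Module.End ℂ (CuspForm (Gamma0 N) k) |
      ∃ (p : ℕ) (hp : p.Prime), T = (haveI : NeZero p := ⟨hp.ne_zero⟩; heckeT (Gamma0 N) k p)} :=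
  Algebra.adjoin_mono (by
    rintro _ ⟨p, hp, -, rfl⟩
    exact ⟨p, hp, rfl⟩)

/-- The generators `T_p`, `T_q` (`p, q ∤ N`) commute (`heckeT_comm_gamma0_holds`;
Diamond–Shurman Prop. 5.2.4, Shimura Thm. 3.41). [cite: DiamondShurman2005, Prop. 5.2.4] -/
theorem anemicHeckeGenerators_comm :
    ∀ x ∈ anemicHeckeGenerators N k, ∀ y ∈ anemicHeckeGenerators N k, x * y = y * x := by
  rintro _ ⟨p, hp, -, rfl⟩ _ ⟨q, hq, -, rfl⟩
  haveI : NeZero p := ⟨hp.ne_zero⟩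
  haveI : NeZero q := ⟨hq.ne_zero⟩
  exact heckeT_comm_gamma0_holds N k p q

/-- **`𝕋` is commutative** (Pasten 2024, §4.8: "Hecke correspondences generate a commutative
ring"; Diamond–Shurman Prop. 5.2.4). A `Prop`-valued mixin on the H21 type `anemicHeckeRing N k`;
no Mathlib instance is shadowed. [cite: PastenShimura2024, §4.8 p. 15] -/
instance instIsMulCommutativeAnemicHeckeRing : IsMulCommutative (anemicHeckeRing N k) :=
  Algebra.isMulCommutative_adjoin ℤ (anemicHeckeGenerators_comm N k)

open scoped IsMulCommutative in
/-- **`𝕋` as a commutative ring** (the `Ring` structure of the subalgebra together with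
`instIsMulCommutativeAnemicHeckeRing`), so that ideals, quotients `𝕋 ⧸ P` and minimal primes of
`𝕋` are available to users without opening the `IsMulCommutative` scope. An instance on the H21
type `anemicHeckeRing N k`; its `Ring` part is the subalgebra's, so no diamond arises. [folklore] -/
instance instCommRingAnemicHeckeRing : CommRing (anemicHeckeRing N k) :=
  inferInstance

/-- **A `T_p`-stable full lattice in `S_k(Γ₀(N))`, every weight** (Shimura 1971, (3.5.20) /
Thm. 3.48, for `Γ₀(N)`): there is an `ℝ`-basis of `S_k(Γ₀(N))` whose `ℤ`-span is stable under all
`T_p`, `p` prime. For `k ≥ 2` this is the tree's theorem `gamma0_exists_heckeStableLattice_holds`;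
for `k ≤ 0` (`cuspForm_eq_zero_of_weight_nonpos`) and `k = 1` (`eq_zero_of_odd_weight_gamma0`)
the space is `0` and the empty basis works. [cite: Shimura1971, (3.5.20) p. 84 and Thm. 3.48] -/
theorem exists_heckeStable_realBasis :
    ∃ (n : ℕ) (b : Module.Basis (Fin n) ℝ (CuspForm (Gamma0 N) k)),
      ∀ (p : ℕ) (hp : p.Prime) (i : Fin n),
        (haveI : NeZero p := ⟨hp.ne_zero⟩; heckeT (Gamma0 N) k p (b i)) ∈
          Submodule.span ℤ (Set.range b) := by
  rcases le_or_gt 2 k with hk | hk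
  · exact gamma0_exists_heckeStableLattice_holds N k hk
  · have h0 : ∀ f : CuspForm (Gamma0 N) k, f = 0 := by
      rcases le_or_gt k 0 with hk0 | hk0
      · exact cuspForm_eq_zero_of_weight_nonpos hk0
      · obtain rfl : k = 1 := by omega
        exact eq_zero_of_odd_weight_gamma0 N odd_one
    haveI : Subsingleton (CuspForm (Gamma0 N) k) := ⟨fun f g ↦ by rw [h0 f, h0 g]⟩
    exact ⟨0, Module.Basis.empty _, fun p hp i ↦ i.elim0⟩

/-- **`𝕋` is a finitely generated `ℤ`-module** (Shimura 1971, Thm. 3.48 (1); Diamond–Shurman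
§6.5): it is contained in the full Hecke ring `ℤ[T_p : p prime]`, which is finite over `ℤ` by
the lattice argument of `finite_heckeRing0` applied to `exists_heckeStable_realBasis`. An instance
on the H21 type `anemicHeckeRing N k`. [cite: Shimura1971, Thm. 3.48 (1)] -/
instance instModuleFiniteAnemicHeckeRing : Module.Finite ℤ (anemicHeckeRing N k) := by
  obtain ⟨n, b, hb⟩ := exists_heckeStable_realBasis N k
  haveI := finite_heckeRing0 (N := N) (k := k) rfl b hb
  exact Module.Finite.of_injective
    (Subalgebra.inclusion (anemicHeckeRing_le_adjoin N k)).toLinearMap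
    (Subalgebra.inclusion_injective (anemicHeckeRing_le_adjoin N k))

/-- **`𝕋` is a free `ℤ`-module** (of finite rank): finitely generated and torsion-free inside
the complex vector space `End_ℂ(S_k(Γ₀(N)))` (Shimura 1971, Thm. 3.48 (1)). An instance on the
H21 type `anemicHeckeRing N k`. [cite: Shimura1971, Thm. 3.48 (1)] -/
instance instModuleFreeAnemicHeckeRing : Module.Free ℤ (anemicHeckeRing N k) := by
  haveI : IsAddTorsionFree (Module.End ℂ (CuspForm (Gamma0 N) k)) :=
    IsAddTorsionFree.of_isTorsionFree ℂ _
  haveI : Module.IsTorsionFree ℤ (anemicHeckeRing N k) :=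
    Subtype.val_injective.moduleIsTorsionFree
      (fun x : anemicHeckeRing N k ↦ (x : Module.End ℂ (CuspForm (Gamma0 N) k))) (fun _ _ ↦ rfl)
  exact Module.free_of_finite_type_torsion_free'

/-- `𝕋` is a Noetherian ring (finite over `ℤ`). An instance on the H21 type
`anemicHeckeRing N k`. [folklore] -/
instance instIsNoetherianRingAnemicHeckeRing : IsNoetherianRing (anemicHeckeRing N k) :=
  IsNoetherianRing.of_finite ℤ _

/-- `𝕋` has finitely many minimal primes (it is Noetherian). (By the simultaneous
diagonalizability of `𝕋` on `S_k(Γ₀(N))`, Pasten 2024, §4.9–4.11, the minimal primes of `𝕋` are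
exactly the kernels `𝕀_{[χ]}` of the classes of systems of Hecke eigenvalues, over which the
product in Pasten's Thm. 5.5 runs; that identification is not formalized here.) [folklore] -/
theorem finite_minimalPrimes_anemicHeckeRing : (minimalPrimes (anemicHeckeRing N k)).Finite :=
  minimalPrimes.finite_of_isNoetherianRing _

end HeckeRing

/-! ### Eigen-ideals, eigencharacters and the congruence modulus `η_{[χ₀]}([χ])` -/

section Eigen

variable {N : ℕ} [NeZero N] {k : ℤ}

/-- The **eigen-ideal** (annihilator) of a cusp form `f ∈ S_k(Γ₀(N))` in the Hecke ring:
`{t ∈ 𝕋 | t f = 0}`. For `f` a nonzero simultaneous eigenvector of the `T_p`, `p ∤ N`, with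
eigencharacter `χ_f : 𝕋 → ℂ`, this is `ker χ_f` (`eigenIdeal_eq_ker_eigencharacter`), i.e.
Pasten's `𝕀_{[χ_f]}`, the common kernel of the Galois class `[χ_f]` (2024, §4.11, p. 16). [cite: PastenShimura2024, §4.11 p. 16] -/
def eigenIdeal (f : CuspForm (Gamma0 N) k) : Ideal (anemicHeckeRing N k) where
  carrier := {t | (t : Module.End ℂ (CuspForm (Gamma0 N) k)) f = 0}
  zero_mem' := by simp
  add_mem' {s t} hs ht := by
    simp only [Set.mem_setOf_eq] at hs ht ⊢
    rw [Subalgebra.coe_add, LinearMap.add_apply, hs, ht, add_zero]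
  smul_mem' c {t} ht := by
    simp only [Set.mem_setOf_eq] at ht ⊢
    rw [smul_eq_mul, Subalgebra.coe_mul, Module.End.mul_apply, ht, map_zero]

/-- Membership in the eigen-ideal (unfolding lemma). [folklore] -/
@[simp] theorem mem_eigenIdeal {f : CuspForm (Gamma0 N) k} {t : anemicHeckeRing N k} :
    t ∈ eigenIdeal f ↔ (t : Module.End ℂ (CuspForm (Gamma0 N) k)) f = 0 :=
  Iff.rfl

/-- The eigen-ideal of `0` is everything. [folklore] -/
@[simp] theorem eigenIdeal_zero : eigenIdeal (0 : CuspForm (Gamma0 N) k) = ⊤ := by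
  ext t
  simp

/-- **Pasten's congruence modulus** `η_{[χ₀]}([χ])` attached to a cusp form `f` (in practice the
newform `f_E ∈ V^{χ₀}` of an elliptic curve, `χ₀ : 𝕋 → ℤ`) and an ideal `P` of the Hecke ring
(in practice a minimal prime `P = 𝕀_{[χ]} ≠ 𝕀_{[χ₀]}`): the order of the congruence module
`𝕋 ⧸ (𝕀_{[χ₀]} + P)`, `𝕀_{[χ₀]} = eigenIdeal f` (`0` if infinite, which for minimal primes happens
only for `P = 𝕀_{[χ₀]}`). Pasten (2024, §5.4, p. 17) defines `η_{[χ₀]}([χ]) := [ℤ·f : 𝕀_{[χ]}·f]`;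
since `𝕋` acts on `f` through `χ₀` this is `[ℤ : χ₀(𝕀_{[χ]})] = #(𝕋 ⧸ (ker χ₀ + 𝕀_{[χ]}))`, see
`heckeCongruenceModulus_eq_absNorm`. Its prime divisors are the congruence primes between `f`
and the class `[χ]`; Prop. 5.4 is `heckeCongruenceModulus_dvd_of_mem` /
`dvd_heckeCongruenceModulus_of_forall_dvd`. [cite: PastenShimura2024, §5.4 p. 17] -/
def heckeCongruenceModulus (f : CuspForm (Gamma0 N) k) (P : Ideal (anemicHeckeRing N k)) : ℕ :=
  congruenceModulus (eigenIdeal f) P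

/-- Unfolding lemma: `η_f(P) = #(𝕋 ⧸ (eigenIdeal f + P))`. [folklore] -/
theorem heckeCongruenceModulus_def (f : CuspForm (Gamma0 N) k)
    (P : Ideal (anemicHeckeRing N k)) :
    heckeCongruenceModulus f P = Nat.card (anemicHeckeRing N k ⧸ (eigenIdeal f ⊔ P)) :=
  rfl

/-- A cusp form `f ∈ S_k(Γ₀(N))` is an **(anemic) simultaneous eigenvector** if it is an
eigenvector of `T_p` for every prime `p ∤ N` (no condition at `p ∣ N`, and `f = 0` is allowed).
These are the vectors of the isotypic subspaces `V^χ` of the systems of Hecke eigenvalues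
`χ : 𝕋 → ℂ` (Pasten 2024, §4.9), old forms included; every `IsHeckeEigenform` (eigenvector of all
`T_p`, `U_p`) is one. [cite: PastenShimura2024, §4.9 p. 16] -/
def IsAnemicEigenvector (f : CuspForm (Gamma0 N) k) : Prop :=
  ∀ (p : ℕ) (hp : p.Prime), ¬p ∣ N →
    ∃ a : ℂ, (haveI : NeZero p := ⟨hp.ne_zero⟩; heckeT (Gamma0 N) k p f) = a • f

/-- A Hecke eigenform (eigenvector of every `T_p`) is an anemic simultaneous eigenvector.
[folklore] -/
theorem IsHeckeEigenform.isAnemicEigenvector {f : CuspForm (Gamma0 N) k}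
    (hf : IsHeckeEigenform f) : IsAnemicEigenvector f :=
  fun p hp _ ↦ hf p hp

/-- Every element of `𝕋 = ℤ[T_p : p ∤ N]` acts by a scalar on a simultaneous eigenvector of the
generators. [folklore] -/
theorem IsAnemicEigenvector.exists_apply_eq_smul {f : CuspForm (Gamma0 N) k}
    (hf : IsAnemicEigenvector f) (t : anemicHeckeRing N k) :
    ∃ a : ℂ, (t : Module.End ℂ (CuspForm (Gamma0 N) k)) f = a • f := by
  obtain ⟨t, ht⟩ := t
  change ∃ a : ℂ, t f = a • f
  induction ht using Algebra.adjoin_induction with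
  | mem x hx =>
    obtain ⟨p, hp, hpN, rfl⟩ := hx
    exact hf p hp hpN
  | algebraMap r =>
    refine ⟨r, ?_⟩
    rw [Algebra.algebraMap_eq_smul_one, LinearMap.smul_apply, Module.End.one_apply,
      Int.cast_smul_eq_zsmul]
  | add x y _ _ hx hy =>
    obtain ⟨a, ha⟩ := hx
    obtain ⟨b, hb⟩ := hy
    exact ⟨a + b, by rw [LinearMap.add_apply, ha, hb, add_smul]⟩
  | mul x y _ _ hx hy =>
    obtain ⟨a, ha⟩ := hx
    obtain ⟨b, hb⟩ := hy
    exact ⟨a * b, by rw [Module.End.mul_apply, hb, map_smul, ha, smul_smul, mul_comm]⟩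

open Classical in
/-- The eigenvalue of `t ∈ 𝕋` on `f`: the scalar `a` with `t f = a • f` if there is one, else the
junk value `0` (for `f = 0` the choice is unspecified). [folklore] -/
def anemicEigenvalue (f : CuspForm (Gamma0 N) k) (t : anemicHeckeRing N k) : ℂ :=
  if h : ∃ a : ℂ, (t : Module.End ℂ (CuspForm (Gamma0 N) k)) f = a • f then h.choose else 0

/-- Defining property of `anemicEigenvalue` on a simultaneous eigenvector: `t f = a_t • f`.
[folklore] -/
theorem IsAnemicEigenvector.apply_eq_smul {f : CuspForm (Gamma0 N) k}
    (hf : IsAnemicEigenvector f) (t : anemicHeckeRing N k) :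
    (t : Module.End ℂ (CuspForm (Gamma0 N) k)) f = anemicEigenvalue f t • f := by
  have h := hf.exists_apply_eq_smul t
  rw [anemicEigenvalue, dif_pos h]
  exact h.choose_spec

/-- Uniqueness of the eigenvalue on a nonzero vector. [folklore] -/
theorem anemicEigenvalue_eq_of_apply_eq_smul {f : CuspForm (Gamma0 N) k}
    (hf : IsAnemicEigenvector f) (hf0 : f ≠ 0) {t : anemicHeckeRing N k} {a : ℂ}
    (h : (t : Module.End ℂ (CuspForm (Gamma0 N) k)) f = a • f) : anemicEigenvalue f t = a :=
  smul_left_injective ℂ hf0 ((hf.apply_eq_smul t).symm.trans h)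

/-- The **eigencharacter** (system of Hecke eigenvalues) `χ_f : 𝕋 →+* ℂ` of a nonzero
simultaneous eigenvector `f`: `t f = χ_f(t) f` (Pasten 2024, §4.9: "systems of Hecke eigenvalues
`χ : 𝕋_{D,M} → ℂ`"). [cite: PastenShimura2024, §4.9 p. 16] -/
def eigencharacter {f : CuspForm (Gamma0 N) k} (hf : IsAnemicEigenvector f) (hf0 : f ≠ 0) :
    anemicHeckeRing N k →+* ℂ where
  toFun := anemicEigenvalue f
  map_one' := anemicEigenvalue_eq_of_apply_eq_smul hf hf0 (by simp)
  map_mul' s t := anemicEigenvalue_eq_of_apply_eq_smul hf hf0 (by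
    rw [Subalgebra.coe_mul, Module.End.mul_apply, hf.apply_eq_smul t, map_smul,
      hf.apply_eq_smul s, smul_smul, mul_comm])
  map_zero' := anemicEigenvalue_eq_of_apply_eq_smul hf hf0 (by simp)
  map_add' s t := anemicEigenvalue_eq_of_apply_eq_smul hf hf0 (by
    rw [Subalgebra.coe_add, LinearMap.add_apply, hf.apply_eq_smul s, hf.apply_eq_smul t,
      add_smul])

/-- Defining property of the eigencharacter: `t f = χ_f(t) • f`. [folklore] -/
theorem eigencharacter_spec {f : CuspForm (Gamma0 N) k} (hf : IsAnemicEigenvector f)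
    (hf0 : f ≠ 0) (t : anemicHeckeRing N k) :
    (t : Module.End ℂ (CuspForm (Gamma0 N) k)) f = eigencharacter hf hf0 t • f :=
  hf.apply_eq_smul t

/-- The eigencharacter is characterised by `t f = χ_f(t) • f`. [folklore] -/
theorem eigencharacter_eq_of_apply_eq_smul {f : CuspForm (Gamma0 N) k}
    (hf : IsAnemicEigenvector f) (hf0 : f ≠ 0) {t : anemicHeckeRing N k} {a : ℂ}
    (h : (t : Module.End ℂ (CuspForm (Gamma0 N) k)) f = a • f) : eigencharacter hf hf0 t = a :=
  anemicEigenvalue_eq_of_apply_eq_smul hf hf0 h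

/-- On the generator `T_p` the eigencharacter is the Hecke eigenvalue `a_p(f)`
(`heckeEigenvalue`). [folklore] -/
theorem eigencharacter_T {f : CuspForm (Gamma0 N) k} (hf : IsAnemicEigenvector f) (hf0 : f ≠ 0)
    (p : ℕ) [NeZero p] (hp : p.Prime) (hpN : ¬p ∣ N) :
    eigencharacter hf hf0 (anemicHeckeRing.T N k p hp hpN) = heckeEigenvalue f p :=
  eigencharacter_eq_of_apply_eq_smul hf hf0 (by
    rw [anemicHeckeRing.coe_T]
    exact heckeT_eq_heckeEigenvalue_smul f p (hf p hp hpN))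

/-- **The eigen-ideal is the kernel of the eigencharacter**: `𝕀_{[χ_f]} = ker χ_f`
(Pasten 2024, §4.11). [cite: PastenShimura2024, §4.11 p. 16] -/
theorem eigenIdeal_eq_ker_eigencharacter {f : CuspForm (Gamma0 N) k}
    (hf : IsAnemicEigenvector f) (hf0 : f ≠ 0) :
    eigenIdeal f = RingHom.ker (eigencharacter hf hf0) := by
  ext t
  rw [mem_eigenIdeal, RingHom.mem_ker, eigencharacter_spec hf hf0 t, smul_eq_zero_iff_left hf0]

/-- The eigen-ideal of a nonzero simultaneous eigenvector is a prime ideal of `𝕋` (the kernel of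
a ring map to the field `ℂ`). [folklore] -/
theorem isPrime_eigenIdeal {f : CuspForm (Gamma0 N) k} (hf : IsAnemicEigenvector f)
    (hf0 : f ≠ 0) : (eigenIdeal f).IsPrime := by
  rw [eigenIdeal_eq_ker_eigencharacter hf hf0]
  exact RingHom.ker_isPrime _

/-! #### Integral eigencharacters (`χ₀ : 𝕋 → ℤ`, the case of an elliptic curve) -/

/-- A cusp form has **integral anemic eigenvalues** if `T_p f = a_p f` with `a_p ∈ ℤ` for every
prime `p ∤ N` — e.g. the newform `f_E` of an elliptic curve `E/ℚ` (`a_p = a_p(E)`), whose system of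
eigenvalues `χ₀` is `ℤ`-valued (Pasten 2024, §5.1, p. 17: "Note that `χ₀` is `ℤ`-valued"). [cite: PastenShimura2024, §5.1 p. 17] -/
def HasIntegralEigenvalues (f : CuspForm (Gamma0 N) k) : Prop :=
  ∀ (p : ℕ) (hp : p.Prime), ¬p ∣ N →
    ∃ a : ℤ, (haveI : NeZero p := ⟨hp.ne_zero⟩; heckeT (Gamma0 N) k p f) = (a : ℂ) • f

/-- Integral eigenvalues are eigenvalues. [folklore] -/
theorem HasIntegralEigenvalues.isAnemicEigenvector {f : CuspForm (Gamma0 N) k}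
    (hf : HasIntegralEigenvalues f) : IsAnemicEigenvector f :=
  fun p hp hpN ↦ by
    obtain ⟨a, ha⟩ := hf p hp hpN
    exact ⟨a, ha⟩

/-- If the eigenvalues at the generators are integers, the eigencharacter is `ℤ`-valued on all of
`𝕋 = ℤ[T_p : p ∤ N]`. [folklore] -/
theorem HasIntegralEigenvalues.exists_int_eigencharacter {f : CuspForm (Gamma0 N) k}
    (hf : HasIntegralEigenvalues f) (hf0 : f ≠ 0) (t : anemicHeckeRing N k) :
    ∃ n : ℤ, eigencharacter hf.isAnemicEigenvector hf0 t = n := by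
  obtain ⟨t, ht⟩ := t
  induction ht using Algebra.adjoin_induction with
  | mem x hx =>
    obtain ⟨p, hp, hpN, rfl⟩ := hx
    obtain ⟨a, ha⟩ := hf p hp hpN
    exact ⟨a, eigencharacter_eq_of_apply_eq_smul _ hf0 ha⟩
  | algebraMap r =>
    refine ⟨r, eigencharacter_eq_of_apply_eq_smul _ hf0 ?_⟩
    change (algebraMap ℤ (Module.End ℂ (CuspForm (Gamma0 N) k)) r) f = ((r : ℤ) : ℂ) • f
    rw [Algebra.algebraMap_eq_smul_one, LinearMap.smul_apply, Module.End.one_apply,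
      Int.cast_smul_eq_zsmul]
  | add x y hx hy hx' hy' =>
    obtain ⟨a, ha⟩ := hx'
    obtain ⟨b, hb⟩ := hy'
    refine ⟨a + b, ?_⟩
    have : (⟨x + y, add_mem hx hy⟩ : anemicHeckeRing N k) = ⟨x, hx⟩ + ⟨y, hy⟩ := rfl
    rw [this, map_add, ha, hb, Int.cast_add]
  | mul x y hx hy hx' hy' =>
    obtain ⟨a, ha⟩ := hx'
    obtain ⟨b, hb⟩ := hy'
    refine ⟨a * b, ?_⟩
    have : (⟨x * y, mul_mem hx hy⟩ : anemicHeckeRing N k) = ⟨x, hx⟩ * ⟨y, hy⟩ := rfl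
    rw [this, map_mul, ha, hb, Int.cast_mul]

/-- The **integral eigencharacter** `χ₀ : 𝕋 →+* ℤ` of a nonzero cusp form with integral anemic
eigenvalues (Pasten's `χ₀`, the system of Hecke eigenvalues of an elliptic curve, 2024, §5.1). [cite: PastenShimura2024, §5.1 p. 17] -/
def intEigencharacter {f : CuspForm (Gamma0 N) k} (hf : HasIntegralEigenvalues f)
    (hf0 : f ≠ 0) : anemicHeckeRing N k →+* ℤ where
  toFun t := (hf.exists_int_eigencharacter hf0 t).choose
  map_one' := by
    apply Int.cast_injective (α := ℂ)
    rw [← (hf.exists_int_eigencharacter hf0 1).choose_spec, map_one, Int.cast_one]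
  map_mul' s t := by
    apply Int.cast_injective (α := ℂ)
    rw [← (hf.exists_int_eigencharacter hf0 (s * t)).choose_spec, map_mul, Int.cast_mul,
      ← (hf.exists_int_eigencharacter hf0 s).choose_spec,
      ← (hf.exists_int_eigencharacter hf0 t).choose_spec]
  map_zero' := by
    apply Int.cast_injective (α := ℂ)
    rw [← (hf.exists_int_eigencharacter hf0 0).choose_spec, map_zero, Int.cast_zero]
  map_add' s t := by
    apply Int.cast_injective (α := ℂ)
    rw [← (hf.exists_int_eigencharacter hf0 (s + t)).choose_spec, map_add, Int.cast_add,
      ← (hf.exists_int_eigencharacter hf0 s).choose_spec,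
      ← (hf.exists_int_eigencharacter hf0 t).choose_spec]

/-- The integral eigencharacter is the eigencharacter: `(χ₀ t : ℂ) = χ_f t`. [folklore] -/
@[simp] theorem cast_intEigencharacter {f : CuspForm (Gamma0 N) k}
    (hf : HasIntegralEigenvalues f) (hf0 : f ≠ 0) (t : anemicHeckeRing N k) :
    (intEigencharacter hf hf0 t : ℂ) = eigencharacter hf.isAnemicEigenvector hf0 t :=
  (hf.exists_int_eigencharacter hf0 t).choose_spec.symm

/-- Defining property: `t f = χ₀(t) • f` with `χ₀(t) ∈ ℤ`. [folklore] -/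
theorem intEigencharacter_spec {f : CuspForm (Gamma0 N) k} (hf : HasIntegralEigenvalues f)
    (hf0 : f ≠ 0) (t : anemicHeckeRing N k) :
    (t : Module.End ℂ (CuspForm (Gamma0 N) k)) f = (intEigencharacter hf hf0 t : ℂ) • f := by
  rw [cast_intEigencharacter, ← eigencharacter_spec]

/-- `𝕀_{[χ₀]} = ker χ₀` for the integral eigencharacter. [folklore] -/
theorem eigenIdeal_eq_ker_intEigencharacter {f : CuspForm (Gamma0 N) k}
    (hf : HasIntegralEigenvalues f) (hf0 : f ≠ 0) :
    eigenIdeal f = RingHom.ker (intEigencharacter hf hf0) := by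
  ext t
  rw [mem_eigenIdeal, RingHom.mem_ker, intEigencharacter_spec hf hf0 t, smul_eq_zero_iff_left hf0,
    Int.cast_eq_zero]

/-- **`η` is Pasten's congruence modulus.** For `f ≠ 0` with `ℤ`-valued system of eigenvalues
`χ₀ : 𝕋 → ℤ` and any ideal `P` of `𝕋` (Pasten: `P = 𝕀_{[χ]}`):
`heckeCongruenceModulus f P = [ℤ : χ₀(P)]` (`Ideal.absNorm (P.map χ₀)`), which is Pasten's
`[ℤ·f : P·f]` because `t f = χ₀(t) f` for `t ∈ 𝕋` (2024, §5.4, p. 17). [cite: PastenShimura2024, §5.4 p. 17] -/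
theorem heckeCongruenceModulus_eq_absNorm {f : CuspForm (Gamma0 N) k}
    (hf : HasIntegralEigenvalues f) (hf0 : f ≠ 0) (P : Ideal (anemicHeckeRing N k)) :
    heckeCongruenceModulus f P = Ideal.absNorm (P.map (intEigencharacter hf hf0)) := by
  rw [heckeCongruenceModulus, eigenIdeal_eq_ker_intEigencharacter hf hf0,
    congruenceModulus_ker_eq_absNorm]

/-- **Pasten 2024, Prop. 5.4 (first half):** `η_{[χ₀]}([χ])` divides `χ₀(t)` for every `t` in
`P = 𝕀_{[χ]} = ker χ`; with `t = P(T_{n₁}, …, T_{n_ℓ})` an integer polynomial in Hecke operators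
killed by `χ`, `χ₀(t) = P(χ₀(T_{n₁}), …, χ₀(T_{n_ℓ})) = P(a_{n₁}(E), …, a_{n_ℓ}(E))`. [cite: PastenShimura2024, Prop. 5.4 p. 17] -/
theorem heckeCongruenceModulus_dvd_of_mem {f : CuspForm (Gamma0 N) k}
    (hf : HasIntegralEigenvalues f) (hf0 : f ≠ 0) {P : Ideal (anemicHeckeRing N k)}
    {t : anemicHeckeRing N k} (ht : t ∈ P) :
    (heckeCongruenceModulus f P : ℤ) ∣ intEigencharacter hf hf0 t := by
  rw [heckeCongruenceModulus, eigenIdeal_eq_ker_intEigencharacter hf hf0]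
  exact congruenceModulus_dvd_of_mem _ ht

/-- **Pasten 2024, Prop. 5.4 (second half):** `η_{[χ₀]}([χ])` is the *largest* integer `m` with
`m ∣ χ₀(t)` for all `t ∈ P = ker χ` (every such `m` divides `η`; and every `t ∈ 𝕋` is an integer
polynomial in the `T_n`, `(n, N) = 1`). [cite: PastenShimura2024, Prop. 5.4 p. 17] -/
theorem dvd_heckeCongruenceModulus_of_forall_dvd {f : CuspForm (Gamma0 N) k}
    (hf : HasIntegralEigenvalues f) (hf0 : f ≠ 0) {P : Ideal (anemicHeckeRing N k)} {m : ℕ}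
    (h : ∀ t ∈ P, (m : ℤ) ∣ intEigencharacter hf hf0 t) : m ∣ heckeCongruenceModulus f P := by
  rw [heckeCongruenceModulus, eigenIdeal_eq_ker_intEigencharacter hf hf0]
  exact dvd_congruenceModulus_of_forall_dvd _ h

/-- Evaluation of the Hecke ring at a form: the additive map `𝕋 → S_k(Γ₀(N))`, `t ↦ t f`, whose
image of an ideal `P` is `P·f`. [folklore] -/
def anemicHeckeRing.evalAt (f : CuspForm (Gamma0 N) k) :
    anemicHeckeRing N k →+ CuspForm (Gamma0 N) k where
  toFun t := (t : Module.End ℂ (CuspForm (Gamma0 N) k)) f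
  map_zero' := by simp
  map_add' s t := by rw [Subalgebra.coe_add, LinearMap.add_apply]

/-- Unfolding lemma for `anemicHeckeRing.evalAt`. [folklore] -/
@[simp] theorem anemicHeckeRing.evalAt_apply (f : CuspForm (Gamma0 N) k)
    (t : anemicHeckeRing N k) :
    anemicHeckeRing.evalAt f t = (t : Module.End ℂ (CuspForm (Gamma0 N) k)) f :=
  rfl

/-- **Pasten's definition, literally:** for `f ≠ 0` with `ℤ`-valued eigen-system and any ideal
`P` of `𝕋`, `heckeCongruenceModulus f P = [ℤ·f : P·f]`, the index of the subgroup
`P·f = {t f | t ∈ P}` in `ℤ·f ⊆ S_k(Γ₀(N))` (Pasten 2024, §5.4, p. 17: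
"`η_{[χ₀]}([χ]) := [ℤ·f : 𝕀_{[χ]}·f]` where `f` is any non-zero element of `V^{χ₀}`"; Mathlib's
`AddSubgroup.relIndex`, `0` for infinite index). Proof: `n ↦ n f` maps `ℤ` injectively onto `ℤ·f`
and `χ₀(P)` onto `P·f` (`t f = χ₀(t) f`), and `[ℤ : χ₀(P)] = heckeCongruenceModulus f P`
(`heckeCongruenceModulus_eq_absNorm`). [cite: PastenShimura2024, §5.4 p. 17] -/
theorem heckeCongruenceModulus_eq_relIndex {f : CuspForm (Gamma0 N) k}
    (hf : HasIntegralEigenvalues f) (hf0 : f ≠ 0) (P : Ideal (anemicHeckeRing N k)) :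
    heckeCongruenceModulus f P =
      ((Submodule.toAddSubgroup P).map (anemicHeckeRing.evalAt f)).relIndex
        (AddSubgroup.zmultiples f) := by
  set χ := intEigencharacter hf hf0 with hχ
  set φ : ℤ →+ CuspForm (Gamma0 N) k := zmultiplesHom _ f with hφ_def
  have hφ : Function.Injective φ := by
    intro m n h
    have h' : ((m : ℤ) : ℂ) • f = ((n : ℤ) : ℂ) • f := by
      simpa only [hφ_def, zmultiplesHom_apply, Int.cast_smul_eq_zsmul] using h
    exact Int.cast_injective (smul_left_injective ℂ hf0 h')
  have h1 : AddSubgroup.zmultiples f = (⊤ : AddSubgroup ℤ).map φ := by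
    rw [← AddMonoidHom.range_eq_map, hφ_def, AddSubgroup.range_zmultiplesHom]
  have h2 : (Submodule.toAddSubgroup P).map (anemicHeckeRing.evalAt f) =
      (Submodule.toAddSubgroup (P.map χ)).map φ := by
    ext g
    simp only [AddSubgroup.mem_map, Submodule.mem_toAddSubgroup, anemicHeckeRing.evalAt_apply,
      hφ_def, zmultiplesHom_apply]
    constructor
    · rintro ⟨t, ht, rfl⟩
      refine ⟨χ t, Ideal.mem_map_of_mem χ ht, ?_⟩
      rw [intEigencharacter_spec hf hf0 t, Int.cast_smul_eq_zsmul]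
    · rintro ⟨n, hn, rfl⟩
      obtain ⟨t, ht, rfl⟩ :=
        (Ideal.mem_map_iff_of_surjective χ (surjective_of_ringHom_int χ)).mp hn
      refine ⟨t, ht, ?_⟩
      rw [intEigencharacter_spec hf hf0 t, Int.cast_smul_eq_zsmul]
  rw [h1, h2, AddSubgroup.relIndex_map_map_of_injective _ _ hφ, AddSubgroup.relIndex_top_right,
    heckeCongruenceModulus_eq_absNorm hf hf0, Ideal.absNorm_eq_index]

/-- `𝕋 ⧸ 𝕀_{[χ₀]} ≃+* ℤ` for a nonzero form with integral eigenvalues (`χ₀` is onto `ℤ`).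
[folklore] -/
def quotEigenIdealEquivInt {f : CuspForm (Gamma0 N) k} (hf : HasIntegralEigenvalues f)
    (hf0 : f ≠ 0) : anemicHeckeRing N k ⧸ eigenIdeal f ≃+* ℤ :=
  (Ideal.quotEquivOfEq (eigenIdeal_eq_ker_intEigencharacter hf hf0)).trans
    (RingHom.quotientKerEquivOfSurjective (surjective_of_ringHom_int (intEigencharacter hf hf0)))

end Eigen

end Literature.NumberTheory.EllipticCurves.ModularForms

end
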